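import Summits.CriticalPhenomena.SAWScalingLimit.Theorems.SAWRenewalTightnessConfinementPositivityPinnedDenominator
import HarnessLib

/-!
# Crux `ConfinementPositivity` (stmt-CriticalPhenomena-17587), line `Sketch` (sign-universality):
# stub Num `stub_pinnedNumerator`, part 1 — re-indexing lemmas (`PinnedNum.*`) and the three-piece tube lemma

First helper file for the registered stub Num `stub_pinnedNumerator : UnpinnedSlabTube → HeightLocalRichness →
SmallPiecesCeiling → PinnedTubeFloor` (proved in `…ConfinementPositivityPinnedNumerator.lean`).  Scheme of Num: a
Kesten chain of span `n` pinned at height `y₁ - y₀` inside the tube `|y| ≤ W` is produced by gluing a prefix chain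
`A` staying in the tube `W/8` about its start, ONE steering piece `π` with `n ≤ K · span` carrying the height that
pins the end, and a suffix chain `B` in the tube `W/8` about its start.  Everything is written in the LIST
presentation: chains are `m : List (List Step)` with the side condition `∀ w ∈ m, IsIrrBridge w` inside the
indicator, weight `x_c^{(m.map length).sum}`, span `(m.map xEnd).sum` (`PinnedNum.chainSpanMass_eq_tsum_list`,
`PinnedNum.pieceMass_eq_tsum_list`, from `Theorems.chainTuples_tsum_subtype_eq_tsum_ite`).  This file supplies

* generic `ℝ≥0∞` re-indexing: `PinnedNum.tsum_le_tsum_of_injOn` (comparison of `tsum`s along a map injective on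
  the support), `PinnedNum.psi_injective` (the gluing `(A, B, π) ↦ (A ++ π :: B, |A|)` is injective),
  `PinnedNum.cut_spec` (cutting a list at its first member with `n ≤ K · span`), and the multiplicity count
  `PinnedNum.card_big_le` / `PinnedNum.tsum_nat_big_le` (a list of total span `n ≥ 1` has at most `K` members with
  `n ≤ K · span`);
* the two re-indexing inequalities of Num: `PinnedNum.triple_le_mul_target` (triples whose glued chain meets a
  target condition weigh at most `K` times the chains meeting it) and `PinnedNum.big_le_triple` (chains of span `n`
  with a member of `n ≤ K · span` weigh at most all triples of span `n` with a big steering piece);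
* the registered helper stub `pinnedNum_tube_of_pieces`: the word `wA ++ π ++ wB` started at `y₀` ends at `y₁` and
  stays in `|y| ≤ W` when `wA`, `wB` stay within `r ≤ W/8` of their starts, `π` has height `y₁ - y₀ - Y_A - Y_B`
  and all its heights `y` satisfy `D·min(h,0) - s ≤ D·y ≤ D·max(h,0) + s` with `8s ≤ 3DW`, and `|y₀|, |y₁| ≤ W/2`
  (the trajectory of a concatenation splits by `traj_append_left/right`).

Elementary; no definitions, no named facts.
-/

noncomputable section

open scoped BigOperators ENNReal
open Classical
open Literature.Probability.LatticeModels
open Literature.Probability.RandomPlanarGeometry Literature.Probability.RandomPlanarGeometry.SAW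

namespace Summit.CriticalPhenomena.SAWScalingLimit.Theorems

namespace PinnedNum

/-! ### Generic `ℝ≥0∞` re-indexing -/

/-- Comparison of `tsum`s along a map that is injective on the support of the smaller function. -/
theorem tsum_le_tsum_of_injOn {X Y : Type*} (φ : X → Y) (F : X → ℝ≥0∞) (G : Y → ℝ≥0∞)
    (hle : ∀ x, F x ≤ G (φ x)) (hinj : ∀ x x', F x ≠ 0 → F x' ≠ 0 → φ x = φ x' → x = x') :
    ∑' x, F x ≤ ∑' y, G y := by
  rw [← tsum_subtype_support F]
  calc ∑' x : Function.support F, F x ≤ ∑' x : Function.support F, G (φ x.1) :=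
        ENNReal.tsum_le_tsum fun x => hle x.1
    _ ≤ ∑' y, G y := ENNReal.tsum_comp_le_tsum_of_injective (f := fun x : Function.support F => φ x.1)
        (fun x x' h => Subtype.ext (hinj x.1 x'.1 x.2 x'.2 h)) G

/-- The gluing map `(A, B, π) ↦ (A ++ π :: B, |A|)` is injective. -/
theorem psi_injective {β : Type*} :
    Function.Injective fun x : List β × List β × β => (x.1 ++ x.2.2 :: x.2.1, x.1.length) := by
  rintro ⟨A, B, π⟩ ⟨A', B', π'⟩ h
  simp only [Prod.mk.injEq] at h
  obtain ⟨h1, h2⟩ := h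
  obtain ⟨rfl, h3⟩ := List.append_inj h1 h2
  obtain ⟨rfl, rfl⟩ := List.cons.inj h3
  rfl

/-- The cut at the first member with `n ≤ K · span`: it glues back to the list, and the cut member is big. -/
theorem cut_spec {β : Type*} (f : β → ℤ) (n : ℤ) (K : ℕ) (d : β) (m : List β) (hm : ∃ b ∈ m, n ≤ (K : ℤ) * f b) :
    m.take (m.findIdx fun b => decide (n ≤ (K : ℤ) * f b)) ++
        ((m.drop (m.findIdx fun b => decide (n ≤ (K : ℤ) * f b))).headD d ::
          m.drop ((m.findIdx fun b => decide (n ≤ (K : ℤ) * f b)) + 1)) = m ∧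
      n ≤ (K : ℤ) * f ((m.drop (m.findIdx fun b => decide (n ≤ (K : ℤ) * f b))).headD d) ∧
      (m.drop (m.findIdx fun b => decide (n ≤ (K : ℤ) * f b))).headD d ∈ m := by
  set i := m.findIdx fun b => decide (n ≤ (K : ℤ) * f b) with hi
  have hlt : i < m.length := by
    obtain ⟨b, hb, hbig⟩ := hm
    exact List.findIdx_lt_length_of_exists ⟨b, hb, decide_eq_true hbig⟩
  have hdrop : m.drop i = m[i] :: m.drop (i + 1) := List.drop_eq_getElem_cons hlt
  have hhead : (m.drop i).headD d = m[i] := by rw [hdrop]; rfl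
  rw [hhead]
  refine ⟨by rw [← hdrop, List.take_append_drop], ?_, List.getElem_mem hlt⟩
  have h := List.findIdx_getElem (xs := m) (p := fun b => decide (n ≤ (K : ℤ) * f b)) (w := hlt)
  exact of_decide_eq_true h

/-! ### Multiplicity: at most `K` members of span `≥ n/K` -/

/-- The spans of the members of a list, read off one position at a time, add up to the total span. -/
theorem sum_range_pieceSpan {β : Type*} (f : β → ℤ) : ∀ m : List β,
    (∑ i ∈ Finset.range m.length, (((m.drop i).take 1).map f).sum) = (m.map f).sum
  | [] => by simp
  | b :: m => by
    rw [List.length_cons, Finset.sum_range_succ', List.map_cons, List.sum_cons, add_comm]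
    simp only [List.drop_succ_cons, List.drop_zero, List.take_succ_cons, List.take_zero, List.map_cons,
      List.map_nil, List.sum_cons, List.sum_nil, add_zero]
    rw [sum_range_pieceSpan f m]

/-- A list of nonnegative spans with total `n ≥ 1` has at most `K` positions carrying a span `s` with `n ≤ K s`. -/
theorem card_big_le {β : Type*} (f : β → ℤ) (m : List β) (hm : ∀ b ∈ m, 0 ≤ f b) (n : ℤ) (hn : 1 ≤ n)
    (K : ℕ) (hsum : (m.map f).sum = n) :
    ((Finset.range m.length).filter fun i => n ≤ (K : ℤ) * (((m.drop i).take 1).map f).sum).card ≤ K := by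
  set S := (Finset.range m.length).filter fun i => n ≤ (K : ℤ) * (((m.drop i).take 1).map f).sum with hS
  have hnonneg : ∀ i, 0 ≤ (((m.drop i).take 1).map f).sum := fun i =>
    List.sum_nonneg fun x hx => by
      obtain ⟨b, hb, rfl⟩ := List.mem_map.1 hx
      exact hm b (List.mem_of_mem_drop (List.mem_of_mem_take hb))
  have h1 : (S.card : ℤ) * n ≤ (K : ℤ) * n :=
    calc (S.card : ℤ) * n = ∑ _i ∈ S, n := by rw [Finset.sum_const, nsmul_eq_mul]
      _ ≤ ∑ i ∈ S, (K : ℤ) * (((m.drop i).take 1).map f).sum :=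
          Finset.sum_le_sum fun i hi => (Finset.mem_filter.1 hi).2
      _ = (K : ℤ) * ∑ i ∈ S, (((m.drop i).take 1).map f).sum := (Finset.mul_sum _ _ _).symm
      _ ≤ (K : ℤ) * ∑ i ∈ Finset.range m.length, (((m.drop i).take 1).map f).sum :=
          mul_le_mul_of_nonneg_left
            (Finset.sum_le_sum_of_subset_of_nonneg (Finset.filter_subset _ _) fun i _ _ => hnonneg i)
            (Nat.cast_nonneg K)
      _ = (K : ℤ) * n := by rw [sum_range_pieceSpan, hsum]
  exact_mod_cast le_of_mul_le_mul_right h1 (by omega)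

/-- The multiplicity bound as a `tsum` over the cut position: summing the indicator of "position `i` carries a
big member" against a fixed mass gives at most `K` times the mass. -/
theorem tsum_nat_big_le {β : Type*} (f : β → ℤ) (m : List β) (n : ℤ) (K : ℕ) (C : Prop) [Decidable C]
    (X : ℝ≥0∞) (hC : C → (∀ b ∈ m, 0 ≤ f b) ∧ 1 ≤ n ∧ (m.map f).sum = n) :
    (∑' i : ℕ, if (i < m.length ∧ n ≤ (K : ℤ) * (((m.drop i).take 1).map f).sum ∧ C) then X else 0) ≤
      K * (if C then X else 0) := by
  by_cases hc : C
  · obtain ⟨hm, hn, hsum⟩ := hC hc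
    rw [if_pos hc, tsum_eq_sum (s := Finset.range m.length) fun i hi => if_neg fun h =>
      hi (Finset.mem_range.2 h.1)]
    calc (∑ i ∈ Finset.range m.length,
          if (i < m.length ∧ n ≤ (K : ℤ) * (((m.drop i).take 1).map f).sum ∧ C) then X else 0)
        = ∑ i ∈ Finset.range m.length,
            if n ≤ (K : ℤ) * (((m.drop i).take 1).map f).sum then X else 0 :=
          Finset.sum_congr rfl fun i hi => by simp [Finset.mem_range.1 hi, hc]
      _ = ((Finset.range m.length).filter fun i => n ≤ (K : ℤ) * (((m.drop i).take 1).map f).sum).card * X := by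
          rw [← Finset.sum_filter, Finset.sum_const, nsmul_eq_mul]
      _ ≤ K * X := by
          gcongr
          exact_mod_cast card_big_le f m hm n hn K hsum
  · simp [hc]

/-! ### The list presentation of the masses and the weight of a concatenation -/

/-- Chain masses as `tsum`s over all lists of words of the extension by zero. -/
theorem chainSpanMass_eq_tsum_list (Q : List (List Step) → Prop) [DecidablePred Q] (L : ℤ) :
    (∑' l : {l : List (List Step) // (∀ w ∈ l, IsIrrBridge w) ∧ (l.map xEnd).sum = L ∧ Q l},
        ENNReal.ofReal (criticalFugacity ^ (l.1.map List.length).sum)) =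
      ∑' l : List (List Step), if ((∀ w ∈ l, IsIrrBridge w) ∧ (l.map xEnd).sum = L ∧ Q l) then
        ENNReal.ofReal (criticalFugacity ^ (l.map List.length).sum) else 0 :=
  chainTuples_tsum_subtype_eq_tsum_ite
    (fun l : List (List Step) => (∀ w ∈ l, IsIrrBridge w) ∧ (l.map xEnd).sum = L ∧ Q l)
    (fun l => ENNReal.ofReal (criticalFugacity ^ (l.map List.length).sum))

/-- One-piece masses (over the type of irreducible bridges) as `tsum`s over all words. -/
theorem pieceMass_eq_tsum_list (p : List Step → Prop) [DecidablePred p] :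
    (∑' w : {w : List Step // IsIrrBridge w},
        if p w.1 then ENNReal.ofReal (criticalFugacity ^ w.1.length) else 0) =
      ∑' w : List Step, if (IsIrrBridge w ∧ p w) then ENNReal.ofReal (criticalFugacity ^ w.length) else 0 := by
  rw [chainTuples_tsum_subtype_eq_tsum_ite (fun w : List Step => IsIrrBridge w)
    (fun w => if p w then ENNReal.ofReal (criticalFugacity ^ w.length) else 0)]
  refine tsum_congr fun w => ?_
  by_cases h1 : IsIrrBridge w <;> by_cases h2 : p w <;> simp [h1, h2]

/-- The weight of `A ++ π :: B` is the product of the weights of `A`, `π` and `B`. -/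
theorem weight_append_cons (A B : List (List Step)) (π : List Step) :
    ENNReal.ofReal (criticalFugacity ^ ((A ++ π :: B).map List.length).sum) =
      ENNReal.ofReal (criticalFugacity ^ (A.map List.length).sum) *
        ENNReal.ofReal (criticalFugacity ^ π.length) *
          ENNReal.ofReal (criticalFugacity ^ (B.map List.length).sum) := by
  have h0 : (0 : ℝ) ≤ criticalFugacity := KestenIdentity.criticalFugacity_nonneg
  rw [List.map_append, List.map_cons, List.sum_append, List.sum_cons, pow_add, pow_add,
    ENNReal.ofReal_mul (pow_nonneg h0 _), ENNReal.ofReal_mul (pow_nonneg h0 _), mul_assoc]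

/-- The span of `A ++ π :: B` is the sum of the spans. -/
theorem span_append_cons (A B : List (List Step)) (π : List Step) :
    ((A ++ π :: B).map xEnd).sum = (A.map xEnd).sum + xEnd π + (B.map xEnd).sum := by
  rw [List.map_append, List.map_cons, List.sum_append, List.sum_cons, add_assoc]

/-- All members of `A ++ π :: B` are irreducible bridges iff those of `A`, `π`, and those of `B` are. -/
theorem forall_append_cons_iff (A B : List (List Step)) (π : List Step) :
    (∀ w ∈ A ++ π :: B, IsIrrBridge w) ↔ (∀ w ∈ A, IsIrrBridge w) ∧ IsIrrBridge π ∧ ∀ w ∈ B, IsIrrBridge w := by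
  rw [List.forall_mem_append, List.forall_mem_cons]

/-- A list of irreducible bridges has nonnegative total span. -/
theorem span_nonneg (A : List (List Step)) (hA : ∀ w ∈ A, IsIrrBridge w) : 0 ≤ (A.map xEnd).sum :=
  List.sum_nonneg fun x hx => by
    obtain ⟨w, hw, rfl⟩ := List.mem_map.1 hx
    exact (hA w hw).bridge.xEnd_nonneg

/-! ### The two re-indexing inequalities of Num -/

/-- **Multiplicity bound.**  A family of triples `(A, B, π)` (prefix chain, suffix chain, steering piece) whose
glued chain `A ++ π :: B` has span `n ≥ 1`, whose steering piece has `n ≤ K · span`, and which satisfies a target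
condition, has total weight at most `K` times the weight of the chains of span `n` satisfying the target (each
chain arises from at most `K` triples: at most `K` of its members have `n ≤ K · span`). -/
theorem triple_le_mul_target (n : ℤ) (hn : 1 ≤ n) (K : ℕ)
    (cond : List (List Step) → List (List Step) → List Step → Prop) (target : List (List Step) → Prop)
    [∀ A B π, Decidable (cond A B π)] [DecidablePred target]
    (hcond : ∀ A B π, cond A B π → (∀ w ∈ A, IsIrrBridge w) ∧ (∀ w ∈ B, IsIrrBridge w) ∧ IsIrrBridge π ∧
      (A.map xEnd).sum + xEnd π + (B.map xEnd).sum = n ∧ n ≤ (K : ℤ) * xEnd π ∧ target (A ++ π :: B)) :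
    (∑' A : List (List Step), ∑' B : List (List Step), ∑' π : List Step,
        if cond A B π then ENNReal.ofReal (criticalFugacity ^ (A.map List.length).sum) *
          ENNReal.ofReal (criticalFugacity ^ (B.map List.length).sum) *
            ENNReal.ofReal (criticalFugacity ^ π.length) else 0) ≤
      K * ∑' m : List (List Step), if ((∀ w ∈ m, IsIrrBridge w) ∧ (m.map xEnd).sum = n ∧ target m) then
        ENNReal.ofReal (criticalFugacity ^ (m.map List.length).sum) else 0 := by
  set F : List (List Step) → List (List Step) → List Step → ℝ≥0∞ := fun A B π =>
    if cond A B π then ENNReal.ofReal (criticalFugacity ^ (A.map List.length).sum) *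
      ENNReal.ofReal (criticalFugacity ^ (B.map List.length).sum) *
        ENNReal.ofReal (criticalFugacity ^ π.length) else 0 with hF
  set G : List (List Step) × ℕ → ℝ≥0∞ := fun y =>
    if (y.2 < y.1.length ∧ n ≤ (K : ℤ) * (((y.1.drop y.2).take 1).map xEnd).sum ∧
        ((∀ w ∈ y.1, IsIrrBridge w) ∧ (y.1.map xEnd).sum = n ∧ target y.1)) then
      ENNReal.ofReal (criticalFugacity ^ (y.1.map List.length).sum) else 0 with hG
  have h1 : (∑' A, ∑' B, ∑' π, F A B π) =
      ∑' x : List (List Step) × List (List Step) × List Step, F x.1 x.2.1 x.2.2 := by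
    rw [ENNReal.tsum_prod']
    refine tsum_congr fun A => ?_
    rw [ENNReal.tsum_prod']
  rw [h1]
  calc (∑' x : List (List Step) × List (List Step) × List Step, F x.1 x.2.1 x.2.2)
      ≤ ∑' y : List (List Step) × ℕ, G y := by
        refine tsum_le_tsum_of_injOn (fun x => (x.1 ++ x.2.2 :: x.2.1, x.1.length)) _ G ?_
          (fun x x' _ _ h => psi_injective h)
        rintro ⟨A, B, π⟩
        by_cases hc : cond A B π
        · obtain ⟨hA, hB, hπ, hs, hbig, ht⟩ := hcond A B π hc
          have hG1 : A.length < (A ++ π :: B).length ∧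
              n ≤ (K : ℤ) * ((((A ++ π :: B).drop A.length).take 1).map xEnd).sum ∧
              ((∀ w ∈ A ++ π :: B, IsIrrBridge w) ∧ ((A ++ π :: B).map xEnd).sum = n ∧ target (A ++ π :: B)) := by
            refine ⟨by simp, ?_, (forall_append_cons_iff A B π).2 ⟨hA, hπ, hB⟩, by rw [span_append_cons, hs], ht⟩
            rw [List.drop_left]
            simpa using hbig
          simp only [hF, hG]
          rw [if_pos hc, if_pos hG1, weight_append_cons, mul_right_comm]
        · simp [hF, hc]
    _ = ∑' m : List (List Step), ∑' i : ℕ, G (m, i) := ENNReal.tsum_prod'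
    _ ≤ ∑' m : List (List Step), K * (if ((∀ w ∈ m, IsIrrBridge w) ∧ (m.map xEnd).sum = n ∧ target m) then
          ENNReal.ofReal (criticalFugacity ^ (m.map List.length).sum) else 0) :=
        ENNReal.tsum_le_tsum fun m => tsum_nat_big_le xEnd m n K _ _ fun hc =>
          ⟨fun b hb => (hc.1 b hb).bridge.xEnd_nonneg, hn, hc.2.1⟩
    _ = _ := ENNReal.tsum_mul_left

/-- **Coverage bound.**  The chains of span `n` having a member with `n ≤ K · span` weigh at most the family of all
triples `(A, B, π)` of total span `n` whose steering piece has `n ≤ K · span` (cut at the first big member). -/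
theorem big_le_triple (n : ℤ) (K : ℕ) :
    (∑' m : List (List Step), if ((∀ w ∈ m, IsIrrBridge w) ∧ (m.map xEnd).sum = n ∧
        ∃ w ∈ m, n ≤ (K : ℤ) * xEnd w) then ENNReal.ofReal (criticalFugacity ^ (m.map List.length).sum) else 0) ≤
      ∑' A : List (List Step), ∑' B : List (List Step), ∑' π : List Step,
        if (((∀ w ∈ A, IsIrrBridge w) ∧ ∀ w ∈ B, IsIrrBridge w) ∧ (IsIrrBridge π ∧
            (A.map xEnd).sum + xEnd π + (B.map xEnd).sum = n ∧ n ≤ (K : ℤ) * xEnd π)) then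
          ENNReal.ofReal (criticalFugacity ^ (A.map List.length).sum) *
            ENNReal.ofReal (criticalFugacity ^ (B.map List.length).sum) *
              ENNReal.ofReal (criticalFugacity ^ π.length) else 0 := by
  set R : List (List Step) → List (List Step) → List Step → ℝ≥0∞ := fun A B π =>
    if (((∀ w ∈ A, IsIrrBridge w) ∧ ∀ w ∈ B, IsIrrBridge w) ∧ (IsIrrBridge π ∧
        (A.map xEnd).sum + xEnd π + (B.map xEnd).sum = n ∧ n ≤ (K : ℤ) * xEnd π)) then
      ENNReal.ofReal (criticalFugacity ^ (A.map List.length).sum) *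
        ENNReal.ofReal (criticalFugacity ^ (B.map List.length).sum) *
          ENNReal.ofReal (criticalFugacity ^ π.length) else 0 with hR
  have h1 : (∑' A, ∑' B, ∑' π, R A B π) =
      ∑' x : List (List Step) × List (List Step) × List Step, R x.1 x.2.1 x.2.2 := by
    rw [ENNReal.tsum_prod']
    refine tsum_congr fun A => ?_
    rw [ENNReal.tsum_prod']
  rw [h1]
  -- the cut at the first big member
  let φ : List (List Step) → List (List Step) × List (List Step) × List Step := fun m =>
    (m.take (m.findIdx fun b => decide (n ≤ (K : ℤ) * xEnd b)),
      m.drop ((m.findIdx fun b => decide (n ≤ (K : ℤ) * xEnd b)) + 1),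
      (m.drop (m.findIdx fun b => decide (n ≤ (K : ℤ) * xEnd b))).headD [])
  have hglue : ∀ m : List (List Step), (∃ w ∈ m, n ≤ (K : ℤ) * xEnd w) →
      (φ m).1 ++ (φ m).2.2 :: (φ m).2.1 = m ∧ n ≤ (K : ℤ) * xEnd (φ m).2.2 ∧ (φ m).2.2 ∈ m :=
    fun m hm => cut_spec xEnd n K [] m hm
  refine tsum_le_tsum_of_injOn φ _ _ (fun m => ?_) (fun m m' hm hm' h => ?_)
  · by_cases hc : (∀ w ∈ m, IsIrrBridge w) ∧ (m.map xEnd).sum = n ∧ ∃ w ∈ m, n ≤ (K : ℤ) * xEnd w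
    · obtain ⟨hirr, hsum, hex⟩ := hc
      obtain ⟨hm, hbig, hmem⟩ := hglue m hex
      have hs := span_append_cons (φ m).1 (φ m).2.1 (φ m).2.2
      have hw := weight_append_cons (φ m).1 (φ m).2.1 (φ m).2.2
      rw [hm] at hs hw
      have hcR : (((∀ w ∈ (φ m).1, IsIrrBridge w) ∧ ∀ w ∈ (φ m).2.1, IsIrrBridge w) ∧ (IsIrrBridge (φ m).2.2 ∧
          ((φ m).1.map xEnd).sum + xEnd (φ m).2.2 + ((φ m).2.1.map xEnd).sum = n ∧ n ≤ (K : ℤ) * xEnd (φ m).2.2)) :=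
        ⟨⟨fun w hw' => hirr w (List.mem_of_mem_take hw'), fun w hw' => hirr w (List.mem_of_mem_drop hw')⟩,
          hirr _ hmem, by rw [← hs, hsum], hbig⟩
      rw [if_pos ⟨hirr, hsum, hex⟩]
      simp only [hR]
      rw [if_pos hcR, ← mul_right_comm, ← hw]
    · rw [if_neg hc]
      exact zero_le
  · have hc : (∀ w ∈ m, IsIrrBridge w) ∧ (m.map xEnd).sum = n ∧ ∃ w ∈ m, n ≤ (K : ℤ) * xEnd w := by
      by_contra h'
      exact hm (if_neg h')
    have hc' : (∀ w ∈ m', IsIrrBridge w) ∧ (m'.map xEnd).sum = n ∧ ∃ w ∈ m', n ≤ (K : ℤ) * xEnd w := by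
      by_contra h'
      exact hm' (if_neg h')
    rw [← (hglue m hc.2.2).1, ← (hglue m' hc'.2.2).1, h]

end PinnedNum

/-! ### The three-piece tube lemma -/

/-- **Three-piece tube lemma** (the registered helper stub `pinnedNum_tube_of_pieces` of
stmt-CriticalPhenomena-17587).  If `wA` and `wB` stay within `r` of their starts, `π` has height
`y₁ - y₀ - Y_A - Y_B` and all its heights `y` satisfy `D·min(h,0) - s ≤ D·y ≤ D·max(h,0) + s`, and
`2|y₀| ≤ W`, `2|y₁| ≤ W`, `8r ≤ W`, `8s ≤ 3DW`, then `wA ++ π ++ wB` started at height `y₀` ends at `y₁` and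
stays in `|y| ≤ W`. -/
theorem pinnedNum_tube_of_pieces : ∀ (wA π wB : List Step) (y₀ y₁ : ℤ) (W r : ℕ) (D s : ℤ),
    (∀ i, |traj wA i 1| ≤ (r : ℤ)) → (∀ i, |traj wB i 1| ≤ (r : ℤ)) →
    wEnd π 1 = y₁ - y₀ - wEnd wA 1 - wEnd wB 1 →
    (∀ i, D * min (y₁ - y₀ - wEnd wA 1 - wEnd wB 1) 0 - s ≤ D * traj π i 1 ∧
      D * traj π i 1 ≤ D * max (y₁ - y₀ - wEnd wA 1 - wEnd wB 1) 0 + s) →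
    2 * |y₀| ≤ (W : ℤ) → 2 * |y₁| ≤ (W : ℤ) → 8 * (r : ℤ) ≤ (W : ℤ) → 0 < D → 8 * s ≤ 3 * D * (W : ℤ) →
    y₀ + wEnd (wA ++ (π ++ wB)) 1 = y₁ ∧ ∀ i, |y₀ + traj (wA ++ (π ++ wB)) i 1| ≤ (W : ℤ) := by
  intro wA π wB y₀ y₁ W r D s hA hB hH hOS hy₀ hy₁ hr hD hs
  have ha0 := le_abs_self y₀
  have ha0' := neg_abs_le y₀
  have ha1 := le_abs_self y₁
  have ha1' := neg_abs_le y₁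
  have hYA : |wEnd wA 1| ≤ (r : ℤ) := by rw [← traj_length]; exact hA _
  have hYB : |wEnd wB 1| ≤ (r : ℤ) := by rw [← traj_length]; exact hB _
  obtain ⟨hYA1, hYA2⟩ := abs_le.1 hYA
  obtain ⟨hYB1, hYB2⟩ := abs_le.1 hYB
  refine ⟨?_, fun i => ?_⟩
  · rw [wEnd_append, wEnd_append, Pi.add_apply, Pi.add_apply, hH]
    ring
  rcases le_or_gt i wA.length with hi | hi
  · rw [traj_append_left _ _ hi]
    obtain ⟨h1, h2⟩ := abs_le.1 (hA i)
    rw [abs_le]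
    constructor <;> omega
  · obtain ⟨j, rfl⟩ : ∃ j, i = wA.length + j := ⟨i - wA.length, by omega⟩
    rw [traj_append_right, Pi.add_apply]
    rcases le_or_gt j π.length with hj | hj
    · rw [traj_append_left _ _ hj]
      set h := y₁ - y₀ - wEnd wA 1 - wEnd wB 1 with hh
      set U := max h 0 with hU
      set V := min h 0 with hV
      have hU1 : h ≤ U := le_max_left _ _
      have hU2 : 0 ≤ U := le_max_right _ _
      have hU3 : U = h ∨ U = 0 := max_choice _ _
      have hV1 : V ≤ h := min_le_left _ _
      have hV2 : V ≤ 0 := min_le_right _ _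
      have hV3 : V = h ∨ V = 0 := min_choice _ _
      obtain ⟨hlo, hhi⟩ := hOS j
      -- `8 (y₀ + Y_A + U) ≤ 5 W` and `8 (y₀ + Y_A + V) ≥ -5 W`
      have hup : 8 * (y₀ + wEnd wA 1 + U) ≤ 5 * (W : ℤ) := by
        rcases hU3 with hU3 | hU3 <;> rw [hU3] <;> omega
      have hdn : -(5 * (W : ℤ)) ≤ 8 * (y₀ + wEnd wA 1 + V) := by
        rcases hV3 with hV3 | hV3 <;> rw [hV3] <;> omega
      have kup : D * (y₀ + wEnd wA 1 + traj π j 1) ≤ D * (W : ℤ) := by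
        nlinarith [mul_le_mul_of_nonneg_left hup hD.le]
      have kdn : D * (-(W : ℤ)) ≤ D * (y₀ + wEnd wA 1 + traj π j 1) := by
        nlinarith [mul_le_mul_of_nonneg_left hdn hD.le]
      rw [abs_le, ← add_assoc]
      exact ⟨le_of_mul_le_mul_left kdn hD, le_of_mul_le_mul_left kup hD⟩
    · obtain ⟨u, rfl⟩ : ∃ u, j = π.length + u := ⟨j - π.length, by omega⟩
      rw [traj_append_right, Pi.add_apply, hH]
      obtain ⟨h1, h2⟩ := abs_le.1 (hB u)
      rw [abs_le]
      constructor <;> omega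

end Summit.CriticalPhenomena.SAWScalingLimit.Theorems
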